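import Mathlib.Analysis.InnerProductSpace.PiL2
import Mathlib.Analysis.Calculus.Deriv.Basic
import Mathlib.Analysis.Calculus.LineDeriv.Basic
import HarnessLib

/-!
# Stub Y3 `stub_fderiv_apply_eq_zero_of_eventually_line` for crux `MoebiusLimitExists`
(stmt-CriticalPhenomena-1344), line `Sketch` v18
(lead prover-line-stmt-CriticalPhenomena-1344-c19-0; THEOREM-ONLY, `--supports stmt-CriticalPhenomena-1344`)

**A function vanishing along a line near a point has vanishing directional derivative there.**
For `D : (ℝ³)ⁿ → ℝ` differentiable at `x₀` and a direction `v`, if `D (x₀ + t • v) = 0` for all real `t` near `0`,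
then `fderiv ℝ D x₀ v = 0`.

Proof: by the chain rule (`HasFDerivAt.hasLineDerivAt`) the restriction `t ↦ D (x₀ + t • v)` has derivative
`fderiv ℝ D x₀ v` at `0`; being eventually equal to the constant `0` near `0`, it also has derivative `0` there
(`HasDerivAt.congr_of_eventuallyEq`); derivatives are unique (`HasDerivAt.unique`).  Pure one-variable calculus,
Mathlib only; no definitions are introduced.
-/

noncomputable section

open scoped Topology

namespace Summit.CriticalPhenomena.Ising3DConformalLimit.MoebiusLimitExistsSketchV16

/-- **Stub Y3 — directional derivatives vanish along lines on which the function vanishes.**  For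
`D : (ℝ³)ⁿ → ℝ` differentiable at `x₀` and a direction `v : (ℝ³)ⁿ`, if `D (x₀ + t • v) = 0` for all `t` in a
neighbourhood of `0 : ℝ`, then `fderiv ℝ D x₀ v = 0`: the restriction of `D` to the line `t ↦ x₀ + t • v` has
derivative `fderiv ℝ D x₀ v` at `0` by the chain rule and derivative `0` by local constancy, and derivatives are
unique. [folklore] -/
theorem stub_fderiv_apply_eq_zero_of_eventually_line : ∀ (n : ℕ) (D : (Fin n → EuclideanSpace ℝ (Fin 3)) → ℝ)
    (x₀ v : Fin n → EuclideanSpace ℝ (Fin 3)), DifferentiableAt ℝ D x₀ →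
    (∀ᶠ t in 𝓝 (0:ℝ), D (x₀ + t • v) = 0) → fderiv ℝ D x₀ v = 0 := by
  intro n D x₀ v hD h
  have hlin : HasDerivAt (fun t : ℝ => D (x₀ + t • v)) (fderiv ℝ D x₀ v) 0 :=
    hD.hasFDerivAt.hasLineDerivAt v
  have hzero : HasDerivAt (fun t : ℝ => D (x₀ + t • v)) (0 : ℝ) 0 :=
    (hasDerivAt_const (0 : ℝ) (0 : ℝ)).congr_of_eventuallyEq h
  exact hlin.unique hzero

end Summit.CriticalPhenomena.Ising3DConformalLimit.MoebiusLimitExistsSketchV16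

end
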